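import Literature.IUT.HodgeArakelov.BadPrimeGaussianMonoidsGenuineRecordOrbitOfOrbitLift
import Literature.IUT.HodgeArakelov.BadPrimeGaussianMonoidsGenuineRecordSplittingPair
import Literature.IUT.HodgeArakelov.EtaleThetaDataH14OrbitOfThetaKummer
import Literature.IUT.HodgeArakelov.ThetaEvaluationSettingModelOfOrbitLift
import Literature.IUT.HodgeArakelov.EtaleThetaDataOfSettingCyclotomeTower
import HarnessLib

/-!
# [IUTchII] Prop 2.2 (ii) «determines a specific `μ_{2l}`-orbit `θ^ι(Π_v)`» — the EXISTENCE half and the ORBIT half at the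
# model AND at the genuine `θ_env` data, the class-level inversion binder `h14orbit` PRODUCED from the function-level [EtTh]
# Prop 1.4 (ii) package (proof-only consumer knit; complement of p488082)

S. Mochizuki, *Inter-universal Teichmüller theory II*, kurims Dec-2020 manuscript (render IUTchII-kurims-url-5036b4059555):
Prop 2.2 (ii) p. 66 l. 51–62 («The functorial group-theoretic algorithms `Π_v ↦ θ(Π_v) ⊆ ∞θ(Π_v) ⊆ lim_J H¹(Π_Ÿ(Π_v)|_J,
(l·Δ_Θ)(Π_v))` of Proposition 1.4 …, together with the condition of invariance with respect to `ι` [cf. [EtTh], Proposition 1.4,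
(ii); the proof of [EtTh], Theorem 1.6, (iii)], determines a specific `μ_{2l}`- … orbit `θ^ι(Π_v) ⊆ θ(Π_v)` … within the unique
`{(l·ℤ)×μ_{2l}}`- … orbit contained in the set `θ(Π_v)`»), Rmk 2.1.1 (i) p. 65, Cor 2.8 (i) p. 82, Prop 3.1 (i) p. 87
[claim: Mochizuki2012, status: disputed] (IUTchII §2 Prop 2.2 (ii), kurims p.66); S. Mochizuki, *The étale theta function and its
Frobenioid-theoretic manifestations* [EtTh], Publ. RIMS **45** (2009) (refereed; pages = PRIMS journal PDF): Prop 1.4 (ii) p. 22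
(«`Θ̈(Ü) = −Θ̈(Ü⁻¹)`», «`Θ̈(−Ü) = −Θ̈(Ü)`»), Prop 1.5 (ii)(iii) p. 23, Thm 1.6 (iii) p. 24, Def 2.7 p. 41, Cor 2.19 (ii) p. 64
[cite: MochizukiEtTh2009, Prop 1.4 (ii) p.22]; [AbsAnab] Lem 1.3.8 (FACT-LIST F-0007 `FundamentalExtension.PreservesGeom`).

Cell `abc-iut`, layer L6, seat abc-iut-w5-d169 (gen 9; holder-of-record lineage of `plan/L6/SUBDAG-IUTchII-Prop-31-33-34.md`);
cone node **IUTchII:Prop2.2(ii)** (dag id `N_IUTchII_Prop2_2_ii`; abc-iut-L6-lead §F v1.19da «Prop2.2(ii) knit → w5-d169»);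
GAP-LEDGER row D-G-w4d010-2f (binder of record `h14orbit`). PROOF-ONLY companion: NO definition, NO `Prop` fact, NO instance;
every input is consumed BY NAME; nothing landed is edited or restated.

WHAT IS ALREADY IN THE TREE (not redone). abc-iut-w4-d035's `BadPrimeGaussianMonoidsGenuineRecordSplittingOfThetaKummerOrbit`
(p488082) knits abc-iut-L2-t12's producer `EtaleThetaDataOfSetting.h14orbit_of_thetaKummer` (p465052: the class-level ORBIT binder
CHARACTER FOR CHARACTER from the MINIMAL function-level package {`T : ThetaKummerInput`, `hη : η̈^Θ = κ(Θ̈)`, `hdeck`, pull-back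
`ιFn` with `hιFn`/`hΛ`, «`ιFn Θ̈ = const(−1)·Θ̈`» `hιθ`}) into: the root-class-level (R2)(R3) triple, the Cor 3.5 (ii) junction
inputs `horb`/`hroots` and the Prop 3.1 (i) J3 closer at the genuine record, and the two node-Prop2.2(ii) closers
`prop22_ii'_model_of_inversion_/of_hinv_of_thetaKummerOrbit_of_prop15_of_origin` (= abc-iut-w4-d010 p457679 with `h14orbit`
supplied). THIS FILE lands the four items of node IUTchII:Prop2.2(ii) on the SAME route that p488082 does not carry:
* `EtaleThetaDataOfSetting.thetaIota_nonempty_inversion_of_thetaKummerOrbit` — the EXISTENCE half «a specific `μ_{2l}`-orbit»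
  at the model `D := etaleThetaDataOfSetting′`: `θ^ι(Π_v) ≠ ∅` for the pointed-inversion PAIR `(inversionAlpha C ι hι, ι^Θ)` —
  abc-iut-w4-d004's `thetaIota_nonempty_pairRho` (p438435 lineage) with (R2) `hsign`/`hroot` ⟸ abc-iut-w4-d010's
  `rootLevel_inputs_of_classLevel_orbit` (p457998) fed with `h14sign_of_prop15iii` (F-0591), `h14orbit_of_thetaKummer` (p465052),
  `h14free_of_prop15_of_origin` (F-0591/F-2503/F-2498); deck element ⟸ `exists_deck_element`; `hαγ` ⟸ `toLZ_inversionAlpha_generator`;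
* `EtaleThetaDataOfSetting.prop22_ii'_model_of_hinv_of_preservesGeom_of_thetaKummerOrbit_of_prop15_of_origin` — p457679's
  third ι-datum-reduced closer (`hΔ` BY NAME from [AbsAnab] Lem 1.3.8 = F-0007 at a fundamental extension), `h14orbit` ⟸ p465052
  at the CONSTRUCTED companion `thetaCompanionOfAut ι hΔ hq`;
* `EtaleLevels.horbit_thetaEnvData_inversion_of_thetaKummerOrbit` — the RAW Prop 2.2 (ii) `μ_{2l}`-orbit clause READ IN THE
  LIMIT AT THE GENUINE `θ_env` DATA `EtaleLevels.thetaEnvData C …` (abc-iut-w4-d030): any two `ι`-invariants up to torsion of the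
  image of `θ(Π^tp_{X̲̲})` differ by a torsion class — the dag decl of record `horbit_thetaEnvData_inversion` (p439259) with (R2)(R3)
  and `hker` ALL DISCHARGED (p457998's `_of_classLevel_orbit` twin fed as above; the twin p488082 dropped for the 400-line cap);
* `EtaleLevels.thetaEnv_toRecord_nonempty_inversion_of_thetaKummerOrbit` — the EXISTENCE half AT THE GENUINE RECORD:
  `θ^{i₀}_env(𝕄_*) ≠ ∅` for ANY produced record whose `i₀`-th inversion is the limit action of `ι` — abc-iut-w4-d004's
  `thetaEnv_toRecord_nonempty_pairRhoLim` (p441594) fed as above; so the base-point binders `hθ : θ ∈ θ^{i₀}_env(𝕄_*)` of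
  p488082's J3 closer and of the Cor 3.5 (ii) capstones are NOT vacuous on this route either.
RESIDUAL BY NAME (all binders, no `Δ_Θ`-class-level statement, no `hker`): the model/record data; the [EtTh] inversion datum
(`ι`, `hι : ι(Π^tp_{X̲̲}) = Π^tp_{X̲̲}`, companion `cι` resp. `hinv`/`hΔ`|F-0007 instance/`hq`, `ℤ`-reversal `hZι` at a `toLZ`-generator
`γ`, `ι² = conj δ`, `ι ≡ +1` on `Δ_Θ/l·Δ_Θ`); the named facts `Prop15iii` (F-0591) / `Prop15ii` (F-2503) / `IsEtThOrigin` (F-2498);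
a `CyclotomeTower` (genuine data); (H1) `PiYddCharacteristic C` (F-2633 at the instance); and the MINIMAL function-level [EtTh]
Prop 1.4 (ii) package {`T`, `hη`, `hdeck`, `ιFn`, `hιFn`, `hΛ`, `hιθ`}. HONEST CAVEATS: `ThetaKummerInput` is print's function
carrier typed as DATA (the §1 interface has no carrier for functions on `Ÿ`; over the bare record `h14orbit` stays a hypothesis,
abc-iut-w5-d169 GAP-LEDGER 18:47:02Z); abc-iut-w5-d125's census (GAP-LEDGER D-G-w4d010-2f 21:51:33Z): {`hιFn`, `hΛ`, `hιθ`} with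
genuine constants have NO joint instance at the semi-synthetic model `modelχ` for any vertex-0 inner lift — joint satisfiability
of these binders at a tree model is NOT claimed (the class-level conclusion itself IS model-witnessed: p457878 / p460211 / p460881).
Composition of landed theorems; no side taken on [IUTchIII] Cor 3.12; typed ≠ proved ≠ endorsed; discharged-modulo-named-inputs ≠
proved outright.
-/

noncomputable section

namespace Literature.IUT.HodgeArakelov

open Literature.AnabelianGeometry.EtaleTheta (ContH1 ThetaSetting RootSystem cyclotome)
open Literature.AnabelianGeometry.EtaleTheta
open EtaleThetaDataOfSetting CohomologySystemOfContH1
open _root_.Topology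
open scoped commutatorElement

/-! ### §1. At the model `D := etaleThetaDataOfSetting′`: existence of `θ^ι(Π_v)` and the `PreservesGeom` closer -/

namespace EtaleThetaDataOfSetting

variable {p : ℕ} [Fact p.Prime] {D : Literature.AnabelianGeometry.EtaleTheta.ThetaSetting p}
  {E : D.EtaleThetaData} {l : ℕ} (C : E.DoubleUnderline l)
  (ι : D.PiTemp ≃ₜ* D.PiTemp) (hι : C.Huu.map ι.toMulEquiv.toMonoidHom = C.Huu)

/-- **[IUTchII] Prop 2.2 (ii), EXISTENCE half «a specific `μ_{2l}`-orbit `θ^ι(Π_v)`» AT THE MODEL, NO class-level binder**: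
for the pointed-inversion PAIR `(inversionAlpha C ι hι, ι^Θ)` built from the [EtTh] inversion datum `ι` (with theta companion `cι`,
`ℤ`-reversal at a `toLZ`-generator `γ`, `ι² = conj δ`, `ι ≡ +1` on `Δ_Θ/l·Δ_Θ`), the set `θ^ι(Π_v)` of `ι`-invariants up to torsion of
`θ(Π_v)` (at `D := etaleThetaDataOfSetting′`, abc-iut-L6-t1) is NONEMPTY — abc-iut-w4-d004's `thetaIota_nonempty_pairRho` with its
(R2) inputs `hsign`/`hroot` supplied by abc-iut-w4-d010's `rootLevel_inputs_of_classLevel_orbit` fed with the named facts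
(`h14sign_of_prop15iii`, `h14free_of_prop15_of_origin`) and abc-iut-L2-t12's producer `h14orbit_of_thetaKummer` (the ORBIT clause
from the minimal function-level [EtTh] Prop 1.4 (ii) package); the deck element from `exists_deck_element`.
[claim: Mochizuki2012, status: disputed] (IUTchII §2 Prop 2.2 (ii), kurims p.66) -/
theorem thetaIota_nonempty_inversion_of_thetaKummerOrbit [hN : (PiYdd C).Normal] [hYN : D.GtpYdd.Normal]
    (cι : ThetaSetting.ThetaCompanion ι) (hC : D.Compat) (hS : D.Sec2Hyps) (hO : D.IsEtThOrigin)
    (hchar : PiYddCharacteristic C) (h15 : ThetaSetting.Prop15iii E hC) (h15ii : ThetaSetting.Prop15ii E.toKummerData hC)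
    (S : ThetaSetting.{0}) (eS : (Pi C) ≃ₜ* S.PiX) (hl : S.l = l)
    -- (R1) the inversion datum
    (γ : Pi C) (hγ : C.toLZ γ = Multiplicative.ofAdd 1) (hZι : D.toZ (ι (γ : D.PiTemp)) = (D.toZ (γ : D.PiTemp))⁻¹)
    (δ : Pi C) (hιι : ∀ x : Pi C, ι (ι (x : D.PiTemp)) = (δ : D.PiTemp) * (x : D.PiTemp) * (δ : D.PiTemp)⁻¹)
    (hβ : ∀ a : D.GtpTheta, a ∈ D.DeltaTheta → cι.thetaIso a * a⁻¹ ∈ D.lDeltaTheta l)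
    -- the MINIMAL function-level [EtTh] Prop 1.4 (ii) package (abc-iut-L2-t12)
    (T : D.ThetaKummerInput) (hη : E.etaDd = T.kummerTheta)
    (hdeck : ∀ e' : D.PiTemp, e' ∈ D.GtpY → e' ∉ D.GtpYdd → e' • T.theta = T.const (-1) * T.theta)
    (ιFn : T.Fn →* T.Fn)
    (hιFn : ∀ (g : Pi C) (fn : T.Fn), ιFn ((g : D.PiTemp) • fn) = ι (g : D.PiTemp) • ιFn fn)
    (hΛ : ∀ ζ : cyclotome T.Fn, ContH1Aut.coeffMap D.DeltaTheta cι.thetaIso (thetaCompanion_mem_deltaTheta ι cι)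
        (T.coeff.hom ζ) = T.coeff.hom (cyclotome.map ιFn ζ))
    (hιθ : ιFn T.theta = T.const (-1) * T.theta) :
    ∃ t : (coh C).H1 ⊤, t ∈ (etaleThetaDataOfSetting' C hC hS hchar S eS hl).theta ∧
      IsOfFinAddOrder (pairRho C (inversionAlpha C ι hι) cι.thetaIso (thetaCompanion_phi C ι hι cι)
        (mem_lDeltaTheta_iff_thetaCompanion ι cι l) (mem_PiYdd_iff_of_piYddCharacteristic C hchar _) t - t) := by
  obtain ⟨ε, hε₁, hε₂⟩ := exists_deck_element C hS  -- deck element ([EtTh] Def 2.7), for the sign clause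
  obtain ⟨hsign, hroot, -⟩ := rootLevel_inputs_of_classLevel_orbit C ι hι cι hS hchar γ ε hγ hε₁ hε₂ δ hιι hβ
    (h14sign_of_prop15iii C hC hS h15 ε hε₁) (h14orbit_of_thetaKummer C ι hι cι hS hchar T hη hdeck ιFn hιFn hΛ hιθ)
    (h14free_of_prop15_of_origin C hC hO h15 h15ii γ hγ)
  exact thetaIota_nonempty_pairRho C hC hS hchar S eS hl (inversionAlpha C ι hι) cι.thetaIso (thetaCompanion_phi C ι hι cι)
    (mem_lDeltaTheta_iff_thetaCompanion ι cι l) (mem_PiYdd_iff_of_piYddCharacteristic C hchar _) γ ε hγ hε₁ hε₂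
    (toLZ_inversionAlpha_generator C ι hι γ hγ hZι) hsign hroot

include hι in
/-- **IUTchII:Prop2.2(ii)′ at the model on the NAMED-FACT route for an ARBITRARY topological `ι`, `hΔ` BY NAME from [AbsAnab]
Lem 1.3.8 (F-0007 `FundamentalExtension.PreservesGeom` at a fundamental extension `(F, eF)` modelling `Π_X ↠ G_K`), the (R2)
inversion clause PRODUCED from the MINIMAL function-level [EtTh] Prop 1.4 (ii) package at the CONSTRUCTED companion
`thetaCompanionOfAut ι hΔ hq`** (kurims p. 66): abc-iut-w4-d010's `prop22_ii'_model_of_hinv_of_preservesGeom_of_prop15_of_origin_orbit`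
(p457679) with `h14orbit := h14orbit_of_thetaKummer …` and the deck element from `exists_deck_element`. GIVEN EXACTLY: `ι` with
`hι`, `ι̂ ≡ −1` on `Δ_X^ab` (`hinv`), the F-0007 instance `(F, eF, heF, h138)`, `hq`, `ι² = conj δ`; the named facts `IsEtThOrigin`
(F-2498) / `Prop15iii` (F-0591) / `Prop15ii` (F-2503); {`T`, `hη`, `hdeck`, `ιFn`, `hιFn`, `hΛ`, `hιθ`}. NO class-level binder.
The `_of_inversion_` / `_of_hinv_` twins are abc-iut-w4-d035's (p488082). [claim: Mochizuki2012, status: disputed]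
(IUTchII §2 Prop 2.2 (ii), kurims pp.65-67) -/
theorem prop22_ii'_model_of_hinv_of_preservesGeom_of_thetaKummerOrbit_of_prop15_of_origin
    (hinv : ∀ g ∈ D.toTemperedCurve.DeltaHat, D.toTemperedCurve.completionAut ι g * g ∈
      (⁅D.toTemperedCurve.DeltaHat, D.toTemperedCurve.DeltaHat⁆).topologicalClosure)
    (F : Literature.AnabelianGeometry.AbsoluteAnabelian.FundamentalExtension.{0})
    (eF : F.arith ≃ₜ* D.PiHat) (heF : F.geom.map eF.toMulEquiv.toMonoidHom = D.DeltaHat)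
    (h138 : Literature.AnabelianGeometry.AbsoluteAnabelian.FundamentalExtension.PreservesGeom (F := F)
      (eF.trans ((D.toTemperedCurve.completionAut ι).trans eF.symm)))
    (hq : IsQuotientMap D.toTheta)
    [hN : (PiYdd C).Normal] [hYN : D.GtpYdd.Normal] (hC : D.Compat) (hS : D.Sec2Hyps)
    (hchar : PiYddCharacteristic C) (S : BadPlaceSetting.{0}) (eS : (Pi C) ≃ₜ* S.PiX) (hl : S.l = l)
    {T₀ : TemperedCoverings S (Pi C)}
    (Dec : SubgraphDecomposition S T₀ (etaleThetaDataOfSetting' C hC hS hchar S.toThetaSetting eS hl))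
    (δ : Pi C) (hιι : ∀ x : Pi C, ι (ι (x : D.PiTemp)) = (δ : D.PiTemp) * (x : D.PiTemp) * (δ : D.PiTemp)⁻¹)
    -- the MINIMAL function-level [EtTh] Prop 1.4 (ii) package, `hΛ` at the constructed companion
    (T : D.ThetaKummerInput) (hη : E.etaDd = T.kummerTheta)
    (hdeck : ∀ e' : D.PiTemp, e' ∈ D.GtpY → e' ∉ D.GtpYdd → e' • T.theta = T.const (-1) * T.theta)
    (ιFn : T.Fn →* T.Fn)
    (hιFn : ∀ (g : Pi C) (fn : T.Fn), ιFn ((g : D.PiTemp) • fn) = ι (g : D.PiTemp) • ιFn fn)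
    (hΛ : ∀ ζ : cyclotome T.Fn, ContH1Aut.coeffMap D.DeltaTheta
        (D.thetaCompanionOfAut ι (D.map_deltaTemp_eq_of_preservesGeom ι F eF heF h138) hq).thetaIso
        (thetaCompanion_mem_deltaTheta ι (D.thetaCompanionOfAut ι (D.map_deltaTemp_eq_of_preservesGeom ι F eF heF h138) hq))
        (T.coeff.hom ζ) = T.coeff.hom (cyclotome.map ιFn ζ))
    (hιθ : ιFn T.theta = T.const (-1) * T.theta)
    (hO : D.IsEtThOrigin) (h15 : ThetaSetting.Prop15iii E hC) (h15ii : ThetaSetting.Prop15ii E.toKummerData hC) :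
    Prop22_ii' Dec := by
  obtain ⟨ε, hε₁, hε₂⟩ := exists_deck_element C hS
  exact prop22_ii'_model_of_hinv_of_preservesGeom_of_prop15_of_origin_orbit C ι hι hinv F eF heF h138 hq hC hS hchar S eS
    hl Dec ε hε₁ hε₂ δ hιι
    (h14orbit_of_thetaKummer C ι hι (D.thetaCompanionOfAut ι (D.map_deltaTemp_eq_of_preservesGeom ι F eF heF h138) hq)
      hS hchar T hη hdeck ιFn hιFn hΛ hιθ) hO h15 h15ii

end EtaleThetaDataOfSetting

/-! ### §2. At the GENUINE `θ_env` data: the raw `μ_{2l}`-orbit clause in the limit and `θ^{i₀}_env(𝕄_*) ≠ ∅` -/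

namespace EtaleLevels

open TemperedThetaMonoids BadPrimeGaussianMonoids

variable {p : ℕ} [Fact p.Prime] {D : Literature.AnabelianGeometry.EtaleTheta.ThetaSetting p}
  {E : D.EtaleThetaData} {l : ℕ} (C : E.DoubleUnderline l) (hC : D.Compat) (hS : D.Sec2Hyps)
  (hl : l.Prime) (hp2 : p ≠ 2) (hpl : p ≠ l) (hζ : ∃ ζ : D.K, IsPrimitiveRoot ζ (4 * l))
  (mods : ∀ M : ℕ+, D.CyclotomeMod l M)
  (f : contCocycles D.toTheta D.DeltaTheta C.GtpYdduu) (hf : f ∈ C.rootCocycles hC)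
  (hmods : ∀ (M M' : ℕ+) (h : (M : ℕ) ∣ (M' : ℕ)) (x : D.lDeltaTheta l),
    MuN.red p M M' h ((mods M').red x) = (mods M).red x)
  (h15 : Literature.AnabelianGeometry.EtaleTheta.ThetaSetting.Prop15iii E hC) (L : C.CuspLabels)
  (hZ : ∀ M : ℕ+, Nonempty (ModelCyclotomes.lDeltaQuot (C.rigidData (mods M) hC hS h15 L) ≃*
    Literature.IUT.HodgeTheaters.ZHat))
  (hcharY : EtaleThetaDataOfSetting.PiYddCharacteristic C)
  (hlim : Function.Bijective (rigidLimHom C hC hS hl hp2 hpl hζ mods f hf hmods h15 L hZ))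
  [(EtaleThetaDataOfSetting.PiYdd C).Normal] [hYN : D.GtpYdd.Normal]
  (hO : D.IsEtThOrigin)
  -- the [EtTh] inversion datum (any lift of the pointed inversion)
  (ι : D.PiTemp ≃ₜ* D.PiTemp) (hι : C.Huu.map ι.toMulEquiv.toMonoidHom = C.Huu) (cι : ThetaSetting.ThetaCompanion ι)
  (γ : Pi C) (hγ : C.toLZ γ = Multiplicative.ofAdd 1) (hZι : D.toZ (ι (γ : D.PiTemp)) = (D.toZ (γ : D.PiTemp))⁻¹)
  (δ : Pi C) (hιι : ∀ x : Pi C, ι (ι (x : D.PiTemp)) = (δ : D.PiTemp) * (x : D.PiTemp) * (δ : D.PiTemp)⁻¹)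
  (hβ : ∀ a : D.GtpTheta, a ∈ D.DeltaTheta → cι.thetaIso a * a⁻¹ ∈ D.lDeltaTheta l)
  -- [EtTh] Prop 1.5 (ii) for `E` (F-2503) and the MINIMAL function-level [EtTh] Prop 1.4 (ii) package (abc-iut-L2-t12)
  (h15ii : ThetaSetting.Prop15ii E.toKummerData hC)
  (T : D.ThetaKummerInput) (hη : E.etaDd = T.kummerTheta)
  (hdeck : ∀ e' : D.PiTemp, e' ∈ D.GtpY → e' ∉ D.GtpYdd → e' • T.theta = T.const (-1) * T.theta)
  (ιFn : T.Fn →* T.Fn)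
  (hιFn : ∀ (g : Pi C) (fn : T.Fn), ιFn ((g : D.PiTemp) • fn) = ι (g : D.PiTemp) • ιFn fn)
  (hΛ : ∀ ζ : cyclotome T.Fn, ContH1Aut.coeffMap D.DeltaTheta cι.thetaIso (thetaCompanion_mem_deltaTheta ι cι)
      (T.coeff.hom ζ) = T.coeff.hom (cyclotome.map ιFn ζ))
  (hιθ : ιFn T.theta = T.const (-1) * T.theta)

include hS hO hγ hZι hιι hβ h15ii hη hdeck hιFn hΛ hιθ

/-- **[IUTchII] Prop 2.2 (ii), ORBIT half — the RAW `μ_{2l}`-orbit clause READ IN THE LIMIT AT THE GENUINE `θ_env` DATA, NO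
class-level binder, NO `hker`** (kurims p. 66 / Prop 3.1 (i) p. 87): for the limit action `pairRhoLim C (ι|Π^tp_{X̲̲}) ι^Θ …` of the
[EtTh] inversion `ι` (any lift; theta companion `cι`), any two `ι`-invariants up to torsion of the image of `θ(Π^tp_{X̲̲})` in
`lim_J H¹(Π^tp_{Ÿ̲̲} ∩ J, l·Δ_Θ)` (abc-iut-w4-d030's genuine `EtaleLevels.thetaEnvData C …`) differ by a torsion class — the dag decl
of record `horbit_thetaEnvData_inversion` (abc-iut-w4-d004, p439259) through abc-iut-w4-d010's `horbit_thetaEnvData_inversion_of_classLevel_orbit`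
(p457998) with `h14sign` ⟸ `h14sign_of_prop15iii` (F-0591), `h14free` ⟸ `h14free_of_prop15_of_origin` (F-0591/F-2503/F-2498),
**`h14orbit` ⟸ `h14orbit_of_thetaKummer` (abc-iut-L2-t12, p465052)**, deck element ⟸ `exists_deck_element`, `hker` ⟸ `IsEtThOrigin`
+ the cyclotome tower. [claim: Mochizuki2012, status: disputed] (IUTchII §2 Prop 2.2 (ii), kurims p.66) -/
theorem horbit_thetaEnvData_inversion_of_thetaKummerOrbit {Es : Set ℕ+} (τc : D.CyclotomeTower l Es) :
    ∀ x ∈ (thetaEnvData C hC hS hl hp2 hpl hζ mods f hf hmods h15 L hZ hcharY hlim).thetaIotaLim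
        (pairRhoLim C (inversionAlpha C ι hι) cι.thetaIso (thetaCompanion_phi C ι hι cι)
          (mem_lDeltaTheta_iff_thetaCompanion ι cι l) (mem_PiYdd_iff_of_piYddCharacteristic C hcharY _)),
      ∀ x' ∈ (thetaEnvData C hC hS hl hp2 hpl hζ mods f hf hmods h15 L hZ hcharY hlim).thetaIotaLim
        (pairRhoLim C (inversionAlpha C ι hι) cι.thetaIso (thetaCompanion_phi C ι hι cι)
          (mem_lDeltaTheta_iff_thetaCompanion ι cι l) (mem_PiYdd_iff_of_piYddCharacteristic C hcharY _)),
        IsOfFinAddOrder (x' - x) := by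
  obtain ⟨ε, hε₁, hε₂⟩ := exists_deck_element C hS  -- deck element ([EtTh] Def 2.7), for the sign clause
  exact horbit_thetaEnvData_inversion_of_classLevel_orbit C hC hS hl hp2 hpl hζ mods f hf hmods h15 L hZ hcharY hlim hO τc ι hι
    cι γ ε hγ hε₁ hε₂ hZι δ hιι hβ (h14sign_of_prop15iii C hC hS h15 ε hε₁) (h14free_of_prop15_of_origin C hC hO h15 h15ii γ hγ)
    (h14orbit_of_thetaKummer C ι hι cι hS hcharY T hη hdeck ιFn hιFn hΛ hιθ)

/-- **[IUTchII] Prop 2.2 (ii) / Prop 3.1 (i), EXISTENCE half AT THE GENUINE RECORD — `θ^{i₀}_env(𝕄_*)` IS NONEMPTY, NO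
class-level binder** (kurims p. 66 «a specific `μ_{2l}`-orbit `θ^ι(Π_v)`» — in particular nonempty; Prop 3.1 (i) p. 87): for ANY
produced record `(thetaEnvData …).toRecord act κ iota` whose `i₀`-th inversion is the limit action of the [EtTh] inversion `ι`,
the set `θ^{i₀}_env(𝕄_*)` is inhabited — abc-iut-w4-d004's `thetaEnv_toRecord_nonempty_pairRhoLim` (p441594) at the PAIR
`(inversionAlpha C ι hι, ι^Θ)`, (R2) `hsign`/`hroot` ⟸ `rootLevel_inputs_of_classLevel_orbit` fed with the named facts and
`h14orbit_of_thetaKummer`. So the base-point binders `hθ : θ ∈ θ^{i₀}_env(𝕄_*)` of abc-iut-w4-d035's J3 closer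
`splitting_toRecord_padic_of_eval_inversion_of_thetaKummerOrbit` (p488082) and of the Cor 3.5 (ii) capstones are NOT vacuous on
this route. [claim: Mochizuki2012, status: disputed] (IUTchII §3 Prop 3.1 (i), kurims p.87) -/
theorem thetaEnv_toRecord_nonempty_inversion_of_thetaKummerOrbit {M : Type} [CommMonoid M]
    (act : (modelSystem C hC hS hl hp2 hpl hζ mods f hf hmods h15 L hZ).PiX →*
      MulAut (Multiplicative (thetaEnvData C hC hS hl hp2 hpl hζ mods f hf hmods h15 L hZ hcharY hlim).cohEnv.lim))
    (κ : M →* Multiplicative (thetaEnvData C hC hS hl hp2 hpl hζ mods f hf hmods h15 L hZ hcharY hlim).cohEnv.lim)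
    {Iota : Type}
    (iota : Iota → ((thetaEnvData C hC hS hl hp2 hpl hζ mods f hf hmods h15 L hZ hcharY hlim).D.coh.lim ≃+
      (thetaEnvData C hC hS hl hp2 hpl hζ mods f hf hmods h15 L hZ hcharY hlim).D.coh.lim))
    {i₀ : Iota}
    (hi₀ : iota i₀ = pairRhoLim C (inversionAlpha C ι hι) cι.thetaIso (thetaCompanion_phi C ι hι cι)
      (mem_lDeltaTheta_iff_thetaCompanion ι cι l) (mem_PiYdd_iff_of_piYddCharacteristic C hcharY _)) :
    (((thetaEnvData C hC hS hl hp2 hpl hζ mods f hf hmods h15 L hZ hcharY hlim).toRecord act κ iota).thetaEnv i₀).Nonempty := by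
  obtain ⟨ε, hε₁, hε₂⟩ := exists_deck_element C hS  -- deck element ([EtTh] Def 2.7), for the sign clause
  obtain ⟨hsign, hroot, -⟩ := rootLevel_inputs_of_classLevel_orbit C ι hι cι hS hcharY γ ε hγ hε₁ hε₂ δ hιι hβ
    (h14sign_of_prop15iii C hC hS h15 ε hε₁) (h14orbit_of_thetaKummer C ι hι cι hS hcharY T hη hdeck ιFn hιFn hΛ hιθ)
    (h14free_of_prop15_of_origin C hC hO h15 h15ii γ hγ)
  exact thetaEnv_toRecord_nonempty_pairRhoLim C hC hS hl hp2 hpl hζ mods f hf hmods h15 L hZ hcharY hlim iota act κ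
    (inversionAlpha C ι hι) cι.thetaIso (thetaCompanion_phi C ι hι cι) (mem_lDeltaTheta_iff_thetaCompanion ι cι l)
    (mem_PiYdd_iff_of_piYddCharacteristic C hcharY _) γ ε hγ hε₁ hε₂ (toLZ_inversionAlpha_generator C ι hι γ hγ hZι) hsign
    hroot hi₀

end EtaleLevels

end Literature.IUT.HodgeArakelov

end
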